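import Literature.Geometry.GeometricMeasureTheory.PolyhedralSphereSlices
import Literature.Geometry.GeometricMeasureTheory.WeakLimitRestrict
import Literature.Geometry.GeometricMeasureTheory.CurrentsAdmissiblePushforward
import HarnessLib

/-!
# Sphere slices of weak limits of integral cycles are rectifiable (the slicing step of White's
# closure theorem)

The induction step of B. White's structure-theorem-free proof of the closure theorem for
integral currents [White1989, p. 212; Bandara 2006, Thm. 4.2.1] slices the approximating integral
cycles `Tᵢ ⇀ T'` by spheres: for every centre `x` and almost every radius `r`, the slices
`∂(Tᵢ ⌞ 𝐁(x,r))` are integral cycles of one dimension less, with bounded mass along a subsequence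
(Fatou on the slicing inequality), converging weakly to `∂(T' ⌞ 𝐁(x,r))`; the closure theorem one
dimension down then makes `∂(T' ⌞ 𝐁(x,r))` rectifiable. This file proves exactly this step, with
the induction hypothesis as an explicit hypothesis `IH` ("weak limits of rectifiable
`k`-dimensional BOUNDARIES with bounded mass and support are rectifiable"):

* `Current.boundary_eq_zero_of_tendsto`, `Current.mass_le_of_tendsto` — plumbing: weak limits
  of cycles are cycles, of currents of mass `≤ c` have mass `≤ c` (with the tree's
  `Current.support_subset_of_tendsto`, `Current.IsRepresentable.support_restrictSet_subset_closure`).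
* `Current.exists_polyhedral_tendsto` — **polyhedral approximants**: a weakly convergent
  sequence of rectifiable `(k+1)`-cycles with `𝐌 ≤ c`, `spt ⊆ K` may be replaced by integral
  polyhedral cycles `Pᵢ` of cubical subdivisions of size `εᵢ → 0` (`Tᵢ = Pᵢ + ∂Sᵢ`,
  `𝐌(Sᵢ) ≤ εᵢ γ_S c`, the deformation theorem `Current.IsRectifiable.exists_deformation_of_cycle`
  [Federer1969, 4.2.9]) with the same weak limit, `𝐌(Pᵢ) ≤ γ_P c` and supports in a fixed compact.
* **`Current.ae_isRectifiable_boundary_piece_of_tendsto`** — for `Tᵢ ⇀ T'` as above and `IH` in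
  dimension `k`: for every `x` and a.e. `r > 0`, `∂(T' ⌞ 𝐁(x, r)) ∈ 𝓡_k(V)`. Proof: polyhedral
  approximants; a subsequence with `‖Pᵢ‖ → μ` weakly (`Current.exists_subseq_variation_tendsto`);
  at the radii with `μ(S(x,r)) = 0 = ‖T'‖(S(x,r))` (all but countably many)
  `Pᵢ ⌞ B(x,r) ⇀ T' ⌞ B(x,r)` (`Current.tendsto_restrictSet_apply_of_tendsto`), hence
  `∂(Pᵢ ⌞ B) ⇀ ∂(T' ⌞ B)`; the slices `∂(Pᵢ ⌞ 𝐁(x,r))` are rectifiable for a.e. `r`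
  (`Current.IsRectifiable.ae_isRectifiable_boundary_restrictSet_closedBall`,
  `PolyhedralSphereSlices.lean`) with `𝐌 ≤ C fᵢ'(r)`, `fᵢ = ‖Pᵢ‖ 𝐁(x, ·)`
  (`Current.ae_mass_boundary_piece_le_deriv`), and `∫ fᵢ' ≤ 𝐌(Pᵢ) ≤ γ_P c`
  (`Monotone.lintegral_deriv_le`), so by Fatou `liminfᵢ 𝐌(∂(Pᵢ ⌞ 𝐁(x,r))) < ∞` for a.e. `r`, and
  `IH` applies along a subsequence.
Theorems only; no definitions, no named facts.

## References

* B. White, *A new proof of the compactness theorem for integral currents*, Comment. Math. Helv.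
  64 (1989) 207–220, p. 212 [White1989]; M. L. Bandara, *White's Compactness Theorem for Integral
  Currents* (Monash honours thesis, 2006), Thm. 3.1.3, Thm. 4.2.1 (held:
  `lit paper:galaxy-pdf-8023002039701172160`, pp. 21–24, 39–41).
* H. Federer, *Geometric Measure Theory*, Springer 1969, 4.2.1, 4.2.9, 4.2.16, 4.3.8 [Federer1969].
-/

noncomputable section

open scoped Distributions ENNReal NNReal Topology ContDiff
open MeasureTheory TopologicalSpace Set Filter Metric Function Module

namespace Literature.Geometry.GeometricMeasureTheory

-- Nested operator-norm instances on (duals of) `V [⋀^Fin m]→L[ℝ] ℝ`, as in `Currents.lean`.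
set_option maxSynthPendingDepth 2

open Cubical

variable {V : Type*} [NormedAddCommGroup V] [InnerProductSpace ℝ V] [FiniteDimensional ℝ V]
  [MeasurableSpace V] [BorelSpace V]

/-! ### Plumbing: supports of restrictions and of weak limits -/

section Plumbing

variable {m : ℕ}

omit [FiniteDimensional ℝ V] [MeasurableSpace V] [BorelSpace V] in
/-- **Weak limits of cycles are cycles.** [cite: Federer1969, 4.1.7] -/
theorem Current.boundary_eq_zero_of_tendsto {ι : Type*} {l : Filter ι} [l.NeBot]
    {S : ι → Current (⊤ : Opens V) (m + 1)} {S' : Current (⊤ : Opens V) (m + 1)}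
    (h : ∀ φ, Tendsto (fun i => S i φ) l (𝓝 (S' φ))) (hS : ∀ i, (S i).boundary = 0) :
    S'.boundary = 0 := by
  ext φ
  rw [Current.boundary_apply]
  have h0 : ∀ i, S i (TestForm.extDerivCLM φ) = 0 := fun i => by
    rw [← Current.boundary_apply, hS i]; rfl
  exact tendsto_nhds_unique (h _) (by simp only [h0]; exact tendsto_const_nhds)

omit [FiniteDimensional ℝ V] [MeasurableSpace V] [BorelSpace V] in
/-- The mass of a weak limit of currents of mass `≤ c` is `≤ c`. [cite: Federer1969, 4.1.7] -/
theorem Current.mass_le_of_tendsto {S : ℕ → Current (⊤ : Opens V) m} {S' : Current (⊤ : Opens V) m}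
    (h : ∀ φ, Tendsto (fun i => S i φ) atTop (𝓝 (S' φ))) {c : ℝ≥0∞} (hS : ∀ i, (S i).mass ≤ c) :
    S'.mass ≤ c :=
  (Current.mass_le_liminf_of_tendsto h).trans
    (liminf_le_of_frequently_le' (Eventually.of_forall hS).frequently)

end Plumbing

/-! ### Polyhedral approximants with the same weak limit -/

section Polyhedral

/-- **Polyhedral approximants.** Let `Tᵢ ∈ 𝓡_{k+1}(V)` be cycles with `𝐌(Tᵢ) ≤ c < ∞` and
`spt Tᵢ ⊆ K`, converging weakly to `T'`, and `k + 1 ≤ dim V`. Then there are integral polyhedral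
cycles `Pᵢ` — rectifiable cycles carried by the scaled `(k+1)`-skeleta `μ_{εᵢ} W'_{k+1}` of cubical
subdivisions of sizes `εᵢ = 1/(i+1)` — with `𝐌(Pᵢ) ≤ γ_P c`, supports in the compact
`3√n`-neighbourhood of `K`, and `Pᵢ ⇀ T'`: by the deformation theorem `Tᵢ = Pᵢ + ∂Sᵢ` with
`𝐌(Sᵢ) ≤ εᵢ γ_S c`, so `(Tᵢ - Pᵢ)(φ) = Sᵢ(dφ) → 0`. [cite: Federer1969, 4.2.9; White1989, p. 212] -/
theorem Current.exists_polyhedral_tendsto {k : ℕ} (hkn : k + 1 ≤ Module.finrank ℝ V)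
    {K : Set V} {c : ℝ≥0∞} (hc : c ≠ ⊤)
    {T : ℕ → Current (⊤ : Opens V) (k + 1)} {T' : Current (⊤ : Opens V) (k + 1)}
    (hT : ∀ i, (T i).IsRectifiable ∧ (T i).boundary = 0 ∧ (T i).support ⊆ K ∧ (T i).mass ≤ c)
    (hconv : ∀ φ, Tendsto (fun i => T i φ) atTop (𝓝 (T' φ))) :
    ∃ (P : ℕ → Current (⊤ : Opens V) (k + 1)) (ε : ℕ → ℝ),
      (∀ i, 0 < ε i) ∧
      (∀ i, (P i).IsRectifiable ∧ (P i).boundary = 0 ∧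
        (P i).support ⊆ skeletonV (stdOrthonormalBasis ℝ V) (k + 1) (ε i) ∧
        (P i).support ⊆ cthickening (3 * Real.sqrt (Module.finrank ℝ V)) K ∧
        (P i).mass ≤ ENNReal.ofReal (deformConstP (Module.finrank ℝ V) k) * c) ∧
      ∀ φ, Tendsto (fun i => P i φ) atTop (𝓝 (T' φ)) := by
  classical
  set n := Module.finrank ℝ V with hn
  set b : OrthonormalBasis (Fin n) ℝ V := stdOrthonormalBasis ℝ V with hb
  set ε : ℕ → ℝ := fun i => 1 / ((i : ℝ) + 1) with hε
  have hεpos : ∀ i, 0 < ε i := fun i => by rw [hε]; positivity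
  have hε1 : ∀ i, ε i ≤ 1 := fun i => by
    rw [hε, div_le_one (by positivity)]; linarith [Nat.cast_nonneg (α := ℝ) i]
  choose P S hTPS hPrect hPcyc hSrect hPskel hPspt hSspt hPmass hSmass using
    fun i => (hT i).1.exists_deformation_of_cycle b hkn (hεpos i) (hT i).2.1
  refine ⟨P, ε, hεpos, fun i => ⟨hPrect i, hPcyc i, hPskel i, ?_, ?_⟩, fun φ => ?_⟩
  · refine (hPspt i).trans ?_
    refine (cthickening_mono ?_ _).trans (cthickening_subset_of_subset _ (hT i).2.2.1)
    calc 3 * Real.sqrt n * ε i ≤ 3 * Real.sqrt n * 1 := by gcongr; exact hε1 i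
      _ = 3 * Real.sqrt n := mul_one _
  · exact (hPmass i).trans (by gcongr; exact (hT i).2.2.2)
  · -- `P i φ = T i φ - S i (dφ)` and `|S i (dφ)| ≤ sup ‖dφ‖ · 𝐌(S i) → 0`
    obtain ⟨Cφ, hCφ⟩ : ∃ C, ∀ y, ‖(TestForm.extDerivCLM φ : TestForm (⊤ : Opens V) (k + 1 + 1)) y‖ ≤ C := by
      obtain ⟨C, hC⟩ := (TestForm.extDerivCLM φ : TestForm (⊤ : Opens V) (k + 1 + 1)).hasCompactSupport.exists_bound_of_continuous
        (TestForm.extDerivCLM φ : TestForm (⊤ : Opens V) (k + 1 + 1)).continuous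
      exact ⟨C, hC⟩
    have hC0 : 0 ≤ Cφ := (norm_nonneg _).trans (hCφ 0)
    have hPφ : ∀ i, P i φ = T i φ - S i (TestForm.extDerivCLM φ) := fun i => by
      have h := congrArg (fun X : Current (⊤ : Opens V) (k + 1) => X φ) (hTPS i)
      simp only [add_apply, Current.boundary_apply] at h
      linarith
    have hSbound : ∀ i, |S i (TestForm.extDerivCLM φ)| ≤
        Cφ * (ε i * deformConstS n k * c.toReal) := fun i => by
      have hSm : (S i).mass ≠ ⊤ := ne_top_of_le_ne_top
        (ENNReal.mul_ne_top ENNReal.ofReal_ne_top hc)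
        ((hSmass i).trans (mul_le_mul_right (hT i).2.2.2 _))
      refine ((S i).abs_apply_le_mul_toReal_mass' hSm hC0 hCφ).trans ?_
      refine mul_le_mul_of_nonneg_left ?_ hC0
      have h1 : (S i).mass.toReal ≤ (ENNReal.ofReal (ε i * deformConstS n k) * c).toReal :=
        ENNReal.toReal_mono (ENNReal.mul_ne_top ENNReal.ofReal_ne_top hc)
          ((hSmass i).trans (by gcongr; exact (hT i).2.2.2))
      rw [ENNReal.toReal_mul, ENNReal.toReal_ofReal (mul_nonneg (hεpos i).le ?_)] at h1
      · linarith
      · have := deformConstP_nonneg n k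
        rw [Cubical.deformConstS]; positivity
    have hε0 : Tendsto ε atTop (𝓝 0) := by
      rw [hε]
      exact tendsto_one_div_add_atTop_nhds_zero_nat
    have hS0 : Tendsto (fun i => S i (TestForm.extDerivCLM φ)) atTop (𝓝 0) := by
      rw [tendsto_zero_iff_abs_tendsto_zero]
      refine squeeze_zero (fun i => abs_nonneg _) hSbound ?_
      have : Tendsto (fun i => Cφ * (ε i * deformConstS n k * c.toReal)) atTop
          (𝓝 (Cφ * (0 * deformConstS n k * c.toReal))) :=
        (((hε0.mul_const _).mul_const _).const_mul _)
      simpa using this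
    have : Tendsto (fun i => T i φ - S i (TestForm.extDerivCLM φ)) atTop (𝓝 (T' φ - 0)) :=
      (hconv φ).sub hS0
    rw [sub_zero] at this
    exact this.congr fun i => (hPφ i).symm

end Polyhedral

/-! ### The slices of the limit are rectifiable -/

section Slices

/-- **Sphere slices of a weak limit of integral cycles are rectifiable** (the slicing step of
White's closure theorem [White1989, p. 212; Bandara Thm. 4.2.1]). Let `k + 1 ≤ dim V`, and
suppose the closure theorem holds for rectifiable `k`-dimensional BOUNDARIES (`IH`: weak limits of
sequences `∂Qᵢ ∈ 𝓡_k` with `𝐌(∂Qᵢ) ≤ c' < ∞` and `spt ∂Qᵢ ⊆ K'`, `K'` compact, are rectifiable).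
If `Tᵢ ∈ 𝓡_{k+1}(V)` are cycles with `𝐌(Tᵢ) ≤ c < ∞`, `spt Tᵢ ⊆ K` compact, and `Tᵢ ⇀ T'`, then
for every `x ∈ V` and almost every `r > 0` the boundary of the piece `T' ⌞ 𝐁(x, r)` is a rectifiable
`k`-current. (Polyhedral approximants `Pᵢ ⇀ T'`; a subsequence with `‖Pᵢ‖ → μ`; at the radii with
`μ(S(x,r)) = 0 = ‖T'‖(S(x,r))`, `∂(Pᵢ ⌞ B(x,r)) ⇀ ∂(T' ⌞ B(x,r))`; the polyhedral slices are
rectifiable with `𝐌 ≤ C fᵢ'(r)`, `∫ fᵢ' ≤ 𝐌(Pᵢ) ≤ γ_P c`, so by Fatou a further subsequence has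
bounded slice masses, and `IH` applies.) [cite: White1989, p. 212; Federer1969, 4.2.1, 4.2.16] -/
theorem Current.ae_isRectifiable_boundary_piece_of_tendsto {k : ℕ} (hkn : k + 1 ≤ Module.finrank ℝ V)
    (IH : ∀ (K' : Set V), IsCompact K' → ∀ (c' : ℝ≥0∞), c' ≠ ⊤ →
      ∀ (Q : ℕ → Current (⊤ : Opens V) (k + 1)) (Z' : Current (⊤ : Opens V) k),
        (∀ i, (Q i).boundary.IsRectifiable ∧ (Q i).boundary.support ⊆ K' ∧
          (Q i).boundary.mass ≤ c') →
        (∀ φ, Tendsto (fun i => (Q i).boundary φ) atTop (𝓝 (Z' φ))) → Z'.IsRectifiable)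
    {K : Set V} (hK : IsCompact K) {c : ℝ≥0∞} (hc : c ≠ ⊤)
    {T : ℕ → Current (⊤ : Opens V) (k + 1)} {T' : Current (⊤ : Opens V) (k + 1)}
    (hT : ∀ i, (T i).IsRectifiable ∧ (T i).boundary = 0 ∧ (T i).support ⊆ K ∧ (T i).mass ≤ c)
    (hconv : ∀ φ, Tendsto (fun i => T i φ) atTop (𝓝 (T' φ))) (hT'm : T'.mass ≠ ⊤) (x : V) :
    ∀ᵐ r : ℝ, 0 < r →
      ((T'.isRepresentable_of_mass_ne_top hT'm).restrictSet (closedBall x r)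
        measurableSet_closedBall).boundary.IsRectifiable := by
  classical
  set n := Module.finrank ℝ V with hn
  set b : OrthonormalBasis (Fin n) ℝ V := stdOrthonormalBasis ℝ V with hb
  set hT'r := T'.isRepresentable_of_mass_ne_top hT'm with hT'r_def
  haveI : IsFiniteMeasure T'.variation := T'.isFiniteMeasure_variation hT'm
  -- (1) polyhedral approximants
  obtain ⟨P, ε, hεpos, hP, hPconv⟩ := Current.exists_polyhedral_tendsto hkn hc hT hconv
  set K₁ : Set V := cthickening (3 * Real.sqrt n) K with hK₁
  have hK₁c : IsCompact K₁ := hK.cthickening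
  set cP : ℝ≥0∞ := ENNReal.ofReal (deformConstP n k) * c with hcP
  have hcP : cP ≠ ⊤ := ENNReal.mul_ne_top ENNReal.ofReal_ne_top hc
  have hPm : ∀ i, (P i).mass ≠ ⊤ := fun i => ne_top_of_le_ne_top hcP (hP i).2.2.2.2
  -- (2) a subsequence with weakly convergent variation measures
  obtain ⟨ι, μs, μ, hι, hμs, hμlim⟩ := Current.exists_subseq_variation_tendsto P hcP
    (fun i => (hP i).2.2.2.2) hK₁c (fun i => (hP i).2.2.2.1)
  set P' : ℕ → Current (⊤ : Opens V) (k + 1) := fun j => P (ι j) with hP'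
  have hP'conv : ∀ φ, Tendsto (fun j => P' j φ) atTop (𝓝 (T' φ)) := fun φ =>
    (hPconv φ).comp hι.tendsto_atTop
  have hP'm : ∀ j, (P' j).mass ≠ ⊤ := fun j => hPm (ι j)
  have hP'r : ∀ j, (P' j).IsRepresentable := fun j => (P' j).isRepresentable_of_mass_ne_top (hP'm j)
  -- (3) good radii
  -- (3a) uncharged spheres for `μ` and `‖T'‖`
  have hcountμ : {r : ℝ | 0 < (μ : Measure V) {y | dist y x = r}}.Countable :=
    Measure.countable_meas_level_set_pos (continuous_id.dist continuous_const).measurable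
  have hcountT : {r : ℝ | 0 < T'.variation {y | dist y x = r}}.Countable :=
    Measure.countable_meas_level_set_pos (continuous_id.dist continuous_const).measurable
  -- (3b) rectifiable polyhedral slices, all `j`
  have hslices : ∀ᵐ r : ℝ, ∀ j, 0 < r →
      ((hP'r j).restrictSet (closedBall x r) measurableSet_closedBall).boundary.IsRectifiable ∧
      (hP'r j).restrictSet (closedBall x r) measurableSet_closedBall =
        (hP'r j).restrictSet (ball x r) measurableSet_ball := by
    rw [ae_all_iff]; intro j
    exact (hP (ι j)).1.ae_isRectifiable_boundary_restrictSet_closedBall b (hεpos (ι j)) (hP'r j)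
      (hP (ι j)).2.1 (hP (ι j)).2.2.1 x
  -- (3c) slice masses bounded by the derivative of the mass of balls, all `j`
  set f : ℕ → ℝ → ℝ := fun j s => ((P' j).variation (closedBall x s)).toReal with hf
  set C : ℝ := sliceConst k with hCdef
  have hC0 : 0 ≤ C := sliceConst_nonneg k
  set G : ℕ → ℝ → ℝ≥0∞ := fun j r => ENNReal.ofReal (C * deriv (f j) r) with hG
  have hGm : ∀ j, Measurable (G j) := fun j =>
    ((measurable_deriv (f j)).const_mul C).ennreal_ofReal
  have hmassG : ∀ᵐ r : ℝ, ∀ j, 0 < r →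
      (((P' j).isRepresentable_of_mass_ne_top (hP'm j)).restrictSet (closedBall x r)
        measurableSet_closedBall).boundary.mass ≤ G j r := by
    rw [ae_all_iff]; intro j
    filter_upwards [(P' j).ae_mass_boundary_piece_le_deriv (hP'm j) (hP (ι j)).2.1 x] with r hr hr0
    exact (hr hr0).2
  -- (3d) Fatou: `liminfⱼ G j r < ∞` for a.e. `r > 0`
  have hGint : ∀ j (N : ℕ), ∫⁻ r in Ioo (0 : ℝ) N, G j r ≤ ENNReal.ofReal (C * cP.toReal) := by
    intro j N
    haveI : IsFiniteMeasure (P' j).variation := (P' j).isFiniteMeasure_variation (hP'm j)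
    have hmono : Monotone (f j) := fun a a' haa =>
      ENNReal.toReal_mono (measure_ne_top _ _) (measure_mono (closedBall_subset_closedBall haa))
    have hfle : ∀ s, f j s ≤ cP.toReal := fun s =>
      ENNReal.toReal_mono hcP (((P' j).variation_le_mass _).trans (hP (ι j)).2.2.2.2)
    have hf0 : ∀ s, 0 ≤ f j s := fun s => ENNReal.toReal_nonneg
    calc ∫⁻ r in Ioo (0 : ℝ) N, G j r
        = ∫⁻ r in Ioo (0 : ℝ) N, ENNReal.ofReal C * ENNReal.ofReal (deriv (f j) r) := by
          refine lintegral_congr fun r => ?_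
          rw [hG]; exact ENNReal.ofReal_mul hC0
      _ = ENNReal.ofReal C * ∫⁻ r in Ioo (0 : ℝ) N, ENNReal.ofReal (deriv (f j) r) :=
          lintegral_const_mul _ (measurable_deriv (f j)).ennreal_ofReal
      _ ≤ ENNReal.ofReal C * ENNReal.ofReal (f j N - f j 0) := by
          gcongr; exact Monotone.lintegral_deriv_le hmono 0 N
      _ ≤ ENNReal.ofReal C * ENNReal.ofReal cP.toReal := by
          gcongr; linarith [hfle N, hf0 0]
      _ = ENNReal.ofReal (C * cP.toReal) := (ENNReal.ofReal_mul hC0).symm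
  have hfatou : ∀ N : ℕ, ∀ᵐ r : ℝ, r ∈ Ioo (0 : ℝ) N → liminf (fun j => G j r) atTop < ⊤ := by
    intro N
    have hmeas : Measurable fun r => liminf (fun j => G j r) atTop := Measurable.liminf hGm
    have hle : ∫⁻ r in Ioo (0 : ℝ) N, liminf (fun j => G j r) atTop ≤ ENNReal.ofReal (C * cP.toReal) :=
      (lintegral_liminf_le hGm).trans
        (liminf_le_of_frequently_le' (Eventually.of_forall fun j => hGint j N).frequently)
    have := ae_lt_top' hmeas.aemeasurable (ne_top_of_le_ne_top ENNReal.ofReal_ne_top hle)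
    exact (ae_restrict_iff' measurableSet_Ioo).1 this
  rw [← ae_all_iff] at hfatou
  -- (4) at a good radius
  filter_upwards [hcountμ.ae_notMem volume, hcountT.ae_notMem volume, hslices, hmassG, hfatou]
    with r hrμ hrT hsl hmG hfat hr
  simp only [not_lt, nonpos_iff_eq_zero] at hrμ hrT
  have hsphμ : (μ : Measure V) (sphere x r) = 0 := hrμ
  have hsphT : T'.variation (sphere x r) = 0 := hrT
  -- the closed and open pieces of `T'` agree
  have heqT : hT'r.restrictSet (closedBall x r) measurableSet_closedBall =
      hT'r.restrictSet (ball x r) measurableSet_ball := by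
    refine hT'r.restrictSet_congr_ae _ _ ?_
    have : (ball x r : Set V) =ᵐ[T'.variation] (closedBall x r : Set V) := by
      rw [← ball_union_sphere]
      exact (union_ae_eq_left_of_ae_eq_empty (ae_eq_empty.2 hsphT)).symm
    exact this.symm
  rw [heqT]
  -- (4a) `∂(P' j ⌞ B) ⇀ ∂(T' ⌞ B)`
  have hfront : (μ : Measure V) (frontier (ball x r)) = 0 := by
    rw [frontier_ball x hr.ne']; exact hsphμ
  have hconvB : ∀ φ : TestForm (⊤ : Opens V) k,
      Tendsto (fun j => ((hP'r j).restrictSet (ball x r) measurableSet_ball).boundary φ) atTop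
        (𝓝 ((hT'r.restrictSet (ball x r) measurableSet_ball).boundary φ)) := fun φ => by
    simp only [Current.boundary_apply]
    exact Current.tendsto_restrictSet_apply_of_tendsto hP'r hT'r hT'm hP'conv hμs hμlim isOpen_ball
      hfront _
  -- (4b) a subsequence with bounded slice masses
  obtain ⟨N, hN⟩ := exists_nat_gt r
  have hL : liminf (fun j => G j r) atTop < ⊤ := hfat N ⟨hr, hN⟩
  set L := liminf (fun j => G j r) atTop with hLdef
  have hfreq : ∃ᶠ j in atTop, G j r < L + 1 :=
    frequently_lt_of_liminf_lt (by isBoundedDefault) (ENNReal.lt_add_right hL.ne one_ne_zero)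
  obtain ⟨κ, hκ, hκG⟩ := extraction_of_frequently_atTop hfreq
  -- (4c) the induction hypothesis along the subsequence
  set Q : ℕ → Current (⊤ : Opens V) (k + 1) := fun l =>
    (hP'r (κ l)).restrictSet (ball x r) measurableSet_ball with hQ
  have hQ1 : ∀ l, (Q l).boundary.IsRectifiable := fun l => by
    have h := (hsl (κ l) hr).1
    rwa [(hsl (κ l) hr).2] at h
  have hQ2 : ∀ l, (Q l).boundary.support ⊆ closedBall x r := fun l =>
    (Current.support_boundary_subset _).trans
      (((hP'r (κ l)).support_restrictSet_subset_closure measurableSet_ball).trans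
        (by rw [closure_ball x hr.ne']))
  have hQ3 : ∀ l, (Q l).boundary.mass ≤ L + 1 := fun l => by
    have h1 := hmG (κ l) hr
    have h2 : ((P' (κ l)).isRepresentable_of_mass_ne_top (hP'm (κ l))).restrictSet (closedBall x r)
        measurableSet_closedBall = Q l := by
      rw [hQ]
      exact (hsl (κ l) hr).2
    rw [h2] at h1
    exact h1.trans (hκG l).le
  have hQconv : ∀ φ, Tendsto (fun l => (Q l).boundary φ) atTop
      (𝓝 ((hT'r.restrictSet (ball x r) measurableSet_ball).boundary φ)) := fun φ =>
    (hconvB φ).comp hκ.tendsto_atTop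
  exact IH (closedBall x r) (isCompact_closedBall x r) (L + 1) (ENNReal.add_ne_top.2 ⟨hL.ne, ENNReal.one_ne_top⟩)
    Q _ (fun l => ⟨hQ1 l, hQ2 l, hQ3 l⟩) hQconv

end Slices

end Literature.Geometry.GeometricMeasureTheory
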